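import Mathlib
import Summits.MatrixMultiplication.MatrixMultiplication.Theorems.PauliSmithLocalisationOrbitBound

/-!
# Stub `stub_fixedSpace` (line `Sketch`, crux `FixedPointFreeTargets`, stmt-MatrixMultiplication-15042)

The fixed space of the pinned Pauli sandwich action is the line spanned by the matrix
multiplication tensor `M = ⟨n,n,n⟩` written on `I × I`, `I = Fin k → ZMod p`.

The action of `g = (g₁, g₂, g₃) ∈ ((𝔽_p^k)²)³` on a tensor `x : (I×I) → (I×I) → (I×I) → ℂ` is the
six-slot sandwich by the Weyl–Heisenberg matrices `A = P g₁`, `B = P g₂`, `C = P g₃`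
(`P_(x,z) (v + x) v = χ(z ⬝ v)`): slots `a.1` (by `conj A`) and `b.1` (by `A`), `b.2` (`conj B`) and
`c.1` (`B`), `c.2` (`conj C`) and `a.2` (`C`).

*Core lemma* (`core`): if `Y : I → I → ℂ` satisfies
`∑ u, conj (P x z a u) * ∑ v, P x z b v * Y u v = Y a b` for all `x z a b`, then
`Y a b = if a = b then Y 0 0 else 0`: the shifts (`z = 0`) give `Y (a - s) (b - s) = Y a b`, the
phases (`x = 0`) give `conj (χ (z ⬝ a)) * χ (z ⬝ b) * Y a b = Y a b`, and for `a ≠ b` a coordinate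
vector `z = e_i` with `a i ≠ b i` produces a phase `χ (b i - a i) ≠ 1` (the character is injective).

Specialising the fixed-point equation at `g = ((x,z),0,0)`, `(0,(x,z),0)`, `(0,0,(x,z))` (the other
four matrices are `P 0 0 = 1` and their sums collapse) gives the core hypothesis in the three slot
pairs, whence `x a b c = [a.1 = b.1] [b.2 = c.1] [a.2 = c.2] x 0 0 0`.
-/

set_option linter.dupNamespace false

noncomputable section

namespace Summit.MatrixMultiplication.MatrixMultiplication.Theorems

open Matrix

namespace PauliTautologicalTarget

/-! ### Sum bookkeeping -/

section Sums

variable {I : Type*} [Fintype I] [DecidableEq I]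

omit [DecidableEq I] in
/-- The six-slot sum of the sandwich action, as six nested single sums. -/
theorem sum_six (α ζ α' β β' γ : I → ℂ) (x : I × I → I × I → I × I → ℂ) :
    (∑ a' : I × I, ∑ b' : I × I, ∑ c' : I × I,
      (α a'.1 * ζ a'.2) * (α' b'.1 * β b'.2) * (β' c'.1 * γ c'.2) * x a' b' c') =
    ∑ a₁, α a₁ * ∑ a₂, ζ a₂ * ∑ b₁, α' b₁ * ∑ b₂, β b₂ * ∑ c₁, β' c₁ * ∑ c₂, γ c₂ *
      x (a₁, a₂) (b₁, b₂) (c₁, c₂) := by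
  simp only [Fintype.sum_prod_type, Finset.mul_sum, mul_assoc]

omit [Fintype I] in
/-- A conjugated entry of the identity matrix is itself. -/
theorem conj_one_apply (u j : I) :
    starRingEnd ℂ ((1 : Matrix I I ℂ) u j) = (1 : Matrix I I ℂ) u j := by
  rw [Matrix.one_apply]
  split_ifs <;> simp

/-- Summing against a row of the identity matrix evaluates. -/
theorem one_mul_sum (u : I) (f : I → ℂ) : ∑ j, (1 : Matrix I I ℂ) u j * f j = f u := by
  simp [Matrix.one_apply]

/-- Summing against a conjugated row of the identity matrix evaluates. -/
theorem conj_one_mul_sum (u : I) (f : I → ℂ) :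
    ∑ j, starRingEnd ℂ ((1 : Matrix I I ℂ) u j) * f j = f u := by
  simp_rw [conj_one_apply]
  exact one_mul_sum u f

omit [DecidableEq I] in
/-- Exchanging two weighted sums. -/
theorem sum_swap (φ ψ : I → ℂ) (F : I → I → ℂ) :
    ∑ v, φ v * ∑ u, ψ u * F u v = ∑ u, ψ u * ∑ v, φ v * F u v := by
  simp only [Finset.mul_sum]
  rw [Finset.sum_comm]
  exact Finset.sum_congr rfl fun _ _ => Finset.sum_congr rfl fun _ _ => by ring

end Sums

/-! ### The commutant of the Weyl–Heisenberg matrices is scalar -/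

section Core

variable {p k : ℕ} [NeZero p] {χ : AddChar (ZMod p) ℂ}
  {P : (Fin k → ZMod p) → (Fin k → ZMod p) → Matrix (Fin k → ZMod p) (Fin k → ZMod p) ℂ}

/-- **Core lemma.** A matrix `Y` on `I = Fin k → ZMod p` with `conj (P g) Y (P g)ᵀ = Y` for all
Weyl–Heisenberg matrices `P g` (injective character) is `Y 0 0` times the identity. -/
theorem core (hχ : Function.Injective χ)
    (hP : ∀ x z u v, P x z u v = if u = v + x then χ (z ⬝ᵥ v) else 0)
    (Y : (Fin k → ZMod p) → (Fin k → ZMod p) → ℂ)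
    (hY : ∀ x z a b, ∑ u, starRingEnd ℂ (P x z a u) * ∑ v, P x z b v * Y u v = Y a b)
    (a b : Fin k → ZMod p) : Y a b = if a = b then Y 0 0 else 0 := by
  -- conjugation commutes with `0`-extended indicators
  have hconj : ∀ (q : Prop) [Decidable q] (w : ℂ),
      starRingEnd ℂ (if q then w else 0) = if q then starRingEnd ℂ w else 0 := by
    intro q _ w
    split_ifs <;> simp
  -- shifts: `P_(s,0)` is the permutation matrix of `v ↦ v + s`
  have hP0 : ∀ s u v : Fin k → ZMod p, P s 0 u v = if u - s = v then 1 else 0 := by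
    intro s u v
    rw [hP, zero_dotProduct, AddChar.map_zero_eq_one]
    by_cases h : u = v + s
    · rw [if_pos h, if_pos (sub_eq_iff_eq_add.2 h)]
    · rw [if_neg h, if_neg fun h' => h (sub_eq_iff_eq_add.1 h')]
  have hshift : ∀ s a b : Fin k → ZMod p, Y a b = Y (a - s) (b - s) := by
    intro s a b
    have h := hY s 0 a b
    simp only [hP0, hconj, map_one, ite_mul, one_mul, zero_mul, Finset.sum_ite_eq,
      Finset.mem_univ, if_true] at h
    exact h.symm
  -- phases: `P_(0,z)` is the diagonal matrix `χ (z ⬝ v)`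
  have hphase : ∀ (z : Fin k → ZMod p) (a b : Fin k → ZMod p),
      χ (-(z ⬝ᵥ a) + z ⬝ᵥ b) * Y a b = Y a b := by
    intro z a b
    have h := hY 0 z a b
    simp only [hP, add_zero, hconj, ite_mul, zero_mul, Finset.sum_ite_eq, Finset.mem_univ,
      if_true] at h
    rw [← AddChar.map_neg_eq_conj, ← mul_assoc, ← AddChar.map_add_eq_mul] at h
    exact h
  by_cases hab : a = b
  · subst hab
    rw [if_pos rfl, hshift a a a, sub_self]
  · rw [if_neg hab]
    obtain ⟨i, hi⟩ := Function.ne_iff.1 hab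
    have h := hphase (Pi.single i 1) a b
    rw [single_dotProduct, single_dotProduct, one_mul, one_mul] at h
    have h2 : (χ (-a i + b i) - 1) * Y a b = 0 := by rw [sub_mul, one_mul, h, sub_self]
    rcases mul_eq_zero.1 h2 with h3 | h3
    · exfalso
      rw [sub_eq_zero, ← AddChar.map_zero_eq_one χ] at h3
      exact hi (neg_add_eq_zero.1 (hχ h3))
    · exact h3

/-- The core lemma with the conjugated matrix acting on the first index but summed inside. -/
theorem core' (hχ : Function.Injective χ)
    (hP : ∀ x z u v, P x z u v = if u = v + x then χ (z ⬝ᵥ v) else 0)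
    (Y : (Fin k → ZMod p) → (Fin k → ZMod p) → ℂ)
    (hY : ∀ x z a b, ∑ v, P x z b v * ∑ u, starRingEnd ℂ (P x z a u) * Y u v = Y a b)
    (a b : Fin k → ZMod p) : Y a b = if a = b then Y 0 0 else 0 :=
  core hχ hP Y (fun x z a b => by
    rw [← hY x z a b]
    exact (sum_swap (fun v => P x z b v) (fun u => starRingEnd ℂ (P x z a u)) Y).symm) a b

end Core

/-! ### The fixed space of the pinned sandwich action -/

section Pinned

variable {p k : ℕ}
  {P : (Fin k → ZMod p) → (Fin k → ZMod p) → Matrix (Fin k → ZMod p) (Fin k → ZMod p) ℂ}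
  {act : ((Fin k → ZMod p) × (Fin k → ZMod p)) × ((Fin k → ZMod p) × (Fin k → ZMod p)) ×
      ((Fin k → ZMod p) × (Fin k → ZMod p)) →
    (((Fin k → ZMod p) × (Fin k → ZMod p)) → ((Fin k → ZMod p) × (Fin k → ZMod p)) →
      ((Fin k → ZMod p) × (Fin k → ZMod p)) → ℂ) →
    (((Fin k → ZMod p) × (Fin k → ZMod p)) → ((Fin k → ZMod p) × (Fin k → ZMod p)) →
      ((Fin k → ZMod p) × (Fin k → ZMod p)) → ℂ)}

/-- **Fixed space of the Pauli sandwich**: an `E`-fixed tensor is a multiple of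
`M = ⟨n,n,n⟩` on `I × I` (the commutant of the Weyl–Heisenberg matrices is the scalars, applied in
the three conjugate slot pairs `(a₁,b₁)`, `(b₂,c₁)`, `(c₂,a₂)`). -/
theorem stub_fixedSpace [Fact p.Prime]
    (hP : ∀ x z u v, P x z u v = if u = v + x then
      Complex.exp (2 * Real.pi * Complex.I * ((∑ i, z i * v i).val : ℂ) / (p : ℂ)) else 0)
    (hact : ∀ g x a b c, act g x a b c = ∑ a', ∑ b', ∑ c',
      (starRingEnd ℂ (P g.1.1 g.1.2 a.1 a'.1) * P g.2.2.1 g.2.2.2 a.2 a'.2) *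
      (P g.1.1 g.1.2 b.1 b'.1 * starRingEnd ℂ (P g.2.1.1 g.2.1.2 b.2 b'.2)) *
      (P g.2.1.1 g.2.1.2 c.1 c'.1 * starRingEnd ℂ (P g.2.2.1 g.2.2.2 c.2 c'.2)) * x a' b' c')
    (x : ((Fin k → ZMod p) × (Fin k → ZMod p)) → ((Fin k → ZMod p) × (Fin k → ZMod p)) →
      ((Fin k → ZMod p) × (Fin k → ZMod p)) → ℂ)
    (hx : ∀ g, act g x = x) :
    x = x 0 0 0 • fun a b c : (Fin k → ZMod p) × (Fin k → ZMod p) =>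
      if a.1 = b.1 ∧ b.2 = c.1 ∧ a.2 = c.2 then (1 : ℂ) else 0 := by
  haveI : NeZero p := ⟨(Fact.out : p.Prime).ne_zero⟩
  -- `P` is the Weyl–Heisenberg family of the standard (injective) character
  have hP' : ∀ x z u v, P x z u v =
      if u = v + x then (ZMod.stdAddChar (N := p)) (z ⬝ᵥ v) else 0 := by
    intro x z u v
    rw [hP, ZMod.stdAddChar_apply, ZMod.toCircle_apply]
    rfl
  have hχ : Function.Injective (ZMod.stdAddChar (N := p)) := ZMod.injective_stdAddChar
  have h1 : ∀ u v, P 0 0 u v = (1 : Matrix (Fin k → ZMod p) (Fin k → ZMod p) ℂ) u v := by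
    intro u v
    rw [PauliOrbitBound.pauli_zero hP']
  -- slot pair `(a.1, b.1)`: `g = ((y,z),0,0)`
  have hA : ∀ a b c, x a b c = if a.1 = b.1 then x (0, a.2) (0, b.2) c else 0 := by
    rintro ⟨a₁, a₂⟩ ⟨b₁, b₂⟩ c
    refine core hχ hP' (fun u v => x (u, a₂) (v, b₂) c) (fun y z u₀ v₀ => ?_) a₁ b₁
    have h := congrFun (congrFun (congrFun (hx ((y, z), 0, 0)) (u₀, a₂)) (v₀, b₂)) c
    rw [hact] at h
    simp only [Prod.fst_zero, Prod.snd_zero, h1] at h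
    rw [sum_six (fun i => starRingEnd ℂ (P y z u₀ i)) (fun j => (1 : Matrix _ _ ℂ) a₂ j)
      (fun i => P y z v₀ i) (fun j => starRingEnd ℂ ((1 : Matrix _ _ ℂ) b₂ j))
      (fun l => (1 : Matrix _ _ ℂ) c.1 l) (fun j => starRingEnd ℂ ((1 : Matrix _ _ ℂ) c.2 j))] at h
    simpa only [one_mul_sum, conj_one_mul_sum, Prod.mk.eta] using h
  -- slot pair `(b.2, c.1)`: `g = (0,(y,z),0)`
  have hB : ∀ a b c, x a b c = if b.2 = c.1 then x a (b.1, 0) (0, c.2) else 0 := by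
    rintro a ⟨b₁, b₂⟩ ⟨c₁, c₂⟩
    refine core hχ hP' (fun u v => x a (b₁, u) (v, c₂)) (fun y z u₀ v₀ => ?_) b₂ c₁
    have h := congrFun (congrFun (congrFun (hx (0, (y, z), 0)) a) (b₁, u₀)) (v₀, c₂)
    rw [hact] at h
    simp only [Prod.fst_zero, Prod.snd_zero, h1] at h
    rw [sum_six (fun i => starRingEnd ℂ ((1 : Matrix _ _ ℂ) a.1 i)) (fun j => (1 : Matrix _ _ ℂ) a.2 j)
      (fun i => (1 : Matrix _ _ ℂ) b₁ i) (fun j => starRingEnd ℂ (P y z u₀ j))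
      (fun l => P y z v₀ l) (fun j => starRingEnd ℂ ((1 : Matrix _ _ ℂ) c₂ j))] at h
    simpa only [one_mul_sum, conj_one_mul_sum, Prod.mk.eta] using h
  -- slot pair `(c.2, a.2)` (conjugate on `c.2`): `g = (0,0,(y,z))`
  have hC : ∀ a b c, x a b c = if c.2 = a.2 then x (a.1, 0) b (c.1, 0) else 0 := by
    rintro ⟨a₁, a₂⟩ b ⟨c₁, c₂⟩
    refine core' hχ hP' (fun u v => x (a₁, v) b (c₁, u)) (fun y z u₀ v₀ => ?_) c₂ a₂
    have h := congrFun (congrFun (congrFun (hx (0, 0, (y, z))) (a₁, v₀)) b) (c₁, u₀)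
    rw [hact] at h
    simp only [Prod.fst_zero, Prod.snd_zero, h1] at h
    rw [sum_six (fun i => starRingEnd ℂ ((1 : Matrix _ _ ℂ) a₁ i)) (fun j => P y z v₀ j)
      (fun i => (1 : Matrix _ _ ℂ) b.1 i) (fun j => starRingEnd ℂ ((1 : Matrix _ _ ℂ) b.2 j))
      (fun l => (1 : Matrix _ _ ℂ) c₁ l) (fun j => starRingEnd ℂ (P y z u₀ j))] at h
    simpa only [one_mul_sum, conj_one_mul_sum, Prod.mk.eta] using h
  -- chain the three reductions
  funext a b c
  rw [Pi.smul_apply, Pi.smul_apply, Pi.smul_apply, smul_eq_mul, hA a b c, hB (0, a.2) (0, b.2) c,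
    hC (0, a.2) ((0, b.2).1, 0) (0, c.2)]
  simp only [Prod.mk_zero_zero]
  by_cases h₁ : a.1 = b.1 <;> by_cases h₂ : b.2 = c.1 <;> by_cases h₃ : a.2 = c.2 <;>
    simp [h₁, h₂, h₃, eq_comm]

end Pinned

end PauliTautologicalTarget

end Summit.MatrixMultiplication.MatrixMultiplication.Theorems

end
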